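import Summits.ResolutionOfSingularities.ResolutionOfSingularities.Theorems.FrobeniusLadderFRationalResolutionSegreVertexSingular
import Summits.ResolutionOfSingularities.ResolutionOfSingularities.Theorems.FrobeniusLadderFRationalResolutionSegreDimension
import Summits.ResolutionOfSingularities.ResolutionOfSingularities.Theorems.FrobeniusLadderFRationalResolutionSegreRegularOffVertex
import Summits.ResolutionOfSingularities.ResolutionOfSingularities.Theorems.FrobeniusLadderFRationalResolutionSegreVertexUnique
import Literature.AlgebraicGeometry.Resolution.BlowupsFlatBaseChange
import HarnessLib

/-!
# Cone programme, Segre family: dimension `a + b − 1`, singular locus = the vertex, and the packaged specimen sheet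

Support file for crux stmt-ResolutionOfSingularities-15317 (`FrobeniusLadder.FRationalResolution`), line `redirect`,
CONE PROGRAMME — assembly of `…SegreVertexSingular.lean` (`dim SR[a,b] ≤ a + b − 1`; the vertex is singular when
`dim ≤ m < ab`), `…SegreDimension.lean` (`a + b − 1 ≤ dim SR[a,b]`), `…SegreRegularOffVertex.lean` (regular off the vertex)
and `…SegreVertexUnique.lean` (primes through the vertex are determined), for the Segre ring
`SR[a,b] = k[xᵢyⱼ] ⊆ k[x₁,…,x_a,y₁,…,y_b]`:

* `segre_ringKrullDim_eq` — **`dim SR[a,b] = a + b − 1`** (`a, b ≥ 1`);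
* `segreCone_vertex_not_isRegularLocalRing`, `segreCone_not_mem_regularLocus_of_forall_mem` — for `a, b ≥ 2` a prime
  containing every `xᵢyⱼ` is a SINGULAR point of `Spec SR[a,b]` (no dimension hypothesis left; `Spec.stalkIso`);
* `segreCone_mem_regularLocus_iff` — **`P ∈ Reg(Spec SR[a,b]) ↔ some xᵢyⱼ ∉ P`** (`a, b ≥ 2`);
  `segreCone_compl_regularLocus_eq` — the singular locus is the set of primes containing all the `xᵢyⱼ`;
* `segreCone_existsUnique_vertex` — exactly ONE prime contains all the `xᵢyⱼ` (the kernel of the constant coefficient;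
  uniqueness by `segreVertex_mem_iff`), so `segreCone_compl_regularLocus_eq_singleton`: **the Segre cone has exactly one
  singular point** — an isolated singularity of dimension `a + b − 1`;
* `segreCone_specimen` — the packaged sheet: for every prime `p`, every field `k` of characteristic `p`, all `a, b ≥ 2`:
  `dim = a + b − 1`, domain with every ideal tightly closed (`segreCone_residualClass`, p795533), singular locus a single
  point, and `Spec SR[a,b]` has a resolution of singularities (`hasResolution_segreCone`, p795206: one blow-up of that point).
  With `b = 2`, `a = n − 1` this is a resolved ISOLATED singular member of the residual class of the crux in every dimension
  `n ≥ 3` and every characteristic.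
[folklore; cf. BrunsHerzog1998 §6.1, Ex. 2.2.24; Kollár 2007 §2.2; StacksProject Tag 02OS] Only Mathlib and the landed tree
files above are used; no named published fact.
-/

-- single-problem summit: the doubled namespace component is forced
set_option linter.dupNamespace false

noncomputable section

namespace Summit.ResolutionOfSingularities.ResolutionOfSingularities.Theorems.FRationalResolution

open MvPolynomial AlgebraicGeometry
open Literature.AlgebraicGeometry.Resolution

section Cones

variable (k : Type) [Field k]

/-- The polynomial ring in two blocks of `a` and `b` variables `xᵢ = X (inl i)`, `yⱼ = X (inr j)`. -/
local notation3 "SP[" a ", " b "]" => MvPolynomial (Fin a ⊕ Fin b) k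

/-- The Segre ring `k[xᵢyⱼ] ⊆ k[x, y]` (same term as in the sibling cone-programme files; the named arguments of
`MvPolynomial.X` only fix the elaboration order). -/
local notation3 "SR[" a ", " b "]" =>
  Algebra.adjoin k (Set.range (fun ij : Fin a × Fin b =>
    (MvPolynomial.X (R := k) (σ := Fin a ⊕ Fin b) (Sum.inl ij.1) *
      MvPolynomial.X (R := k) (σ := Fin a ⊕ Fin b) (Sum.inr ij.2) : MvPolynomial (Fin a ⊕ Fin b) k)))

/-- The generator `xᵢyⱼ` as an element of the Segre ring `SR[a,b]`. -/
local notation3 "SG[" a ", " b ", " i ", " j "]" =>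
  (⟨MvPolynomial.X (Sum.inl i) * MvPolynomial.X (Sum.inr j), segreChart_X_mul_X_mem k a b i j⟩ : ↥SR[a, b])

/-! ## Dimension -/

/-- **`dim k[xᵢyⱼ] = a + b − 1`** (`a, b ≥ 1`, witnessed by `i₀ : Fin a`, `j₀ : Fin b`): `segre_ringKrullDim_le`
(injective dehomogenisation) and `segre_le_ringKrullDim` (algebraically independent monomials). [folklore; cf. BrunsHerzog1998 §6.1] -/
theorem segre_ringKrullDim_eq (a b : ℕ) (i₀ : Fin a) (j₀ : Fin b) : ringKrullDim ↥SR[a, b] = (a + b - 1 : ℕ) :=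
  le_antisymm (segre_ringKrullDim_le k a b i₀) (segre_le_ringKrullDim k a b i₀ j₀)

/-! ## The vertex is the unique singular point -/

/-- **The local ring at the vertex is not regular (`a, b ≥ 2`), no dimension hypothesis.** For every prime `q` of `SR[a,b]`
containing all the `xᵢyⱼ`, `SR[a,b]_q` is not a regular local ring: `segreSing_vertex_not_regular` with
`dim SR[a,b] ≤ a + b − 1 < ab` (`segre_ringKrullDim_le`, `add_le_mul`). [folklore; cf. BrunsHerzog1998, Ex. 2.2.24] -/
theorem segreCone_vertex_not_isRegularLocalRing (a b : ℕ) (ha : 2 ≤ a) (hb : 2 ≤ b) (q : PrimeSpectrum ↥SR[a, b])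
    (hq : ∀ v : ↥SR[a, b], (∃ ij : Fin a × Fin b,
      (v : SP[a, b]) = MvPolynomial.X (Sum.inl ij.1) * MvPolynomial.X (Sum.inr ij.2)) → v ∈ q.asIdeal) :
    ¬ IsRegularLocalRing (Localization.AtPrime q.asIdeal) := by
  have hlt : a + b - 1 < a * b := by
    have h := add_le_mul ha hb
    omega
  exact segreSing_vertex_not_regular k a b (segre_ringKrullDim_le k a b ⟨0, by omega⟩) hlt q hq

/-- **A prime containing every `xᵢyⱼ` is a singular point of the Segre cone** (`a, b ≥ 2`): its local ring
`𝒪_{Spec SR[a,b], q} ≅ SR[a,b]_q` (`Spec.stalkIso`) is not regular (`segreCone_vertex_not_isRegularLocalRing`). [folklore] -/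
theorem segreCone_not_mem_regularLocus_of_forall_mem (a b : ℕ) (ha : 2 ≤ a) (hb : 2 ≤ b)
    (q : Spec (CommRingCat.of ↥SR[a, b])) (hq : ∀ (i : Fin a) (j : Fin b), SG[a, b, i, j] ∈ q.asIdeal) :
    q ∉ Scheme.regularLocus (Spec (CommRingCat.of ↥SR[a, b])) := by
  intro hreg
  have hq' : ∀ v : ↥SR[a, b], (∃ ij : Fin a × Fin b,
      (v : SP[a, b]) = MvPolynomial.X (Sum.inl ij.1) * MvPolynomial.X (Sum.inr ij.2)) → v ∈ q.asIdeal := by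
    rintro v ⟨ij, hv⟩
    have hv' : v = SG[a, b, ij.1, ij.2] := Subtype.ext hv
    rw [hv']
    exact hq ij.1 ij.2
  haveI : IsRegularLocalRing ((Spec (CommRingCat.of ↥SR[a, b])).presheaf.stalk q) := hreg
  exact segreCone_vertex_not_isRegularLocalRing k a b ha hb q hq'
    (IsRegularLocalRing.of_ringEquiv (Spec.stalkIso (CommRingCat.of ↥SR[a, b]) q).commRingCatIsoToRingEquiv)

/-- **The regular locus of the Segre cone (`a, b ≥ 2`): `P` is a regular point iff some `xᵢyⱼ ∉ P`.**
(`⇐`: `segreCone_mem_regularLocus_of_not_mem` — the blow-up is an isomorphism with regular source over `D(xᵢyⱼ)`;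
`⇒`: `segreCone_not_mem_regularLocus_of_forall_mem`.) [folklore] -/
theorem segreCone_mem_regularLocus_iff (a b : ℕ) (ha : 2 ≤ a) (hb : 2 ≤ b) (P : Spec (CommRingCat.of ↥SR[a, b])) :
    P ∈ Scheme.regularLocus (Spec (CommRingCat.of ↥SR[a, b])) ↔ ∃ (i : Fin a) (j : Fin b), SG[a, b, i, j] ∉ P.asIdeal := by
  constructor
  · intro hP
    by_contra h
    push Not at h
    exact segreCone_not_mem_regularLocus_of_forall_mem k a b ha hb P h hP
  · rintro ⟨i, j, hij⟩
    exact segreCone_mem_regularLocus_of_not_mem k a b P i j hij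

/-- **The singular locus of the Segre cone is the set of primes containing all the `xᵢyⱼ`** (`a, b ≥ 2`). [folklore] -/
theorem segreCone_compl_regularLocus_eq (a b : ℕ) (ha : 2 ≤ a) (hb : 2 ≤ b) :
    (Scheme.regularLocus (Spec (CommRingCat.of ↥SR[a, b])))ᶜ =
      {P : Spec (CommRingCat.of ↥SR[a, b]) | ∀ (i : Fin a) (j : Fin b), SG[a, b, i, j] ∈ P.asIdeal} := by
  ext P
  rw [Set.mem_compl_iff, segreCone_mem_regularLocus_iff k a b ha hb P, Set.mem_setOf_eq]
  push Not
  rfl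

/-- **Exactly one point of the Segre cone has all `xᵢyⱼ = 0`: the vertex.** Existence: the kernel of the constant
coefficient `SR[a,b] → k` is a prime containing every `xᵢyⱼ`; uniqueness: a prime containing them all is the set of
elements with vanishing constant coefficient (`segreVertex_mem_iff`). [folklore] -/
theorem segreCone_existsUnique_vertex (a b : ℕ) :
    ∃! q : Spec (CommRingCat.of ↥SR[a, b]), ∀ (i : Fin a) (j : Fin b), SG[a, b, i, j] ∈ q.asIdeal := by
  classical
  -- existence: the kernel of the constant coefficient
  let ε : ↥SR[a, b] →+* k := (constantCoeff : SP[a, b] →+* k).comp (SR[a, b]).val.toRingHom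
  let q : Spec (CommRingCat.of ↥SR[a, b]) := ⟨RingHom.ker ε, RingHom.ker_isPrime ε⟩
  have hq : ∀ (i : Fin a) (j : Fin b), SG[a, b, i, j] ∈ q.asIdeal := by
    intro i j
    change ε _ = 0
    simp only [ε, RingHom.comp_apply]
    change constantCoeff (X (Sum.inl i) * X (Sum.inr j) : SP[a, b]) = 0
    rw [map_mul, constantCoeff_X, constantCoeff_X, mul_zero]
  have hgen : ∀ (P : Spec (CommRingCat.of ↥SR[a, b])), (∀ (i : Fin a) (j : Fin b), SG[a, b, i, j] ∈ P.asIdeal) →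
      ∀ v : ↥SR[a, b], (∃ ij : Fin a × Fin b,
        (v : SP[a, b]) = MvPolynomial.X (Sum.inl ij.1) * MvPolynomial.X (Sum.inr ij.2)) → v ∈ P.asIdeal := by
    rintro P hP v ⟨ij, hv⟩
    have hv' : v = SG[a, b, ij.1, ij.2] := Subtype.ext hv
    rw [hv']
    exact hP ij.1 ij.2
  refine ⟨q, hq, fun P hP => ?_⟩
  apply PrimeSpectrum.ext
  ext t
  rw [segreVertex_mem_iff k a b P.asIdeal (hgen P hP) t,
    @segreVertex_mem_iff k _ a b q.asIdeal (RingHom.ker_isPrime ε) (hgen q hq) t]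

/-- **THE SEGRE CONE HAS EXACTLY ONE SINGULAR POINT** (`a, b ≥ 2`): `Sing(Spec k[xᵢyⱼ]) = {vertex}` — an isolated
singularity (`segreCone_compl_regularLocus_eq`, `segreCone_existsUnique_vertex`). [folklore; cf. BrunsHerzog1998 §6.1] -/
theorem segreCone_compl_regularLocus_eq_singleton (a b : ℕ) (ha : 2 ≤ a) (hb : 2 ≤ b) :
    ∃ q : Spec (CommRingCat.of ↥SR[a, b]), (Scheme.regularLocus (Spec (CommRingCat.of ↥SR[a, b])))ᶜ = {q} := by
  obtain ⟨q, hq, huq⟩ := segreCone_existsUnique_vertex k a b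
  refine ⟨q, ?_⟩
  rw [segreCone_compl_regularLocus_eq k a b ha hb]
  ext P
  simp only [Set.mem_setOf_eq, Set.mem_singleton_iff]
  exact ⟨fun hP => huq P hP, fun hP => hP ▸ hq⟩

/-! ## The specimen sheet -/

/-- **THE SEGRE CONES — SPECIMEN SHEET.** For every prime `p`, every field `k` of characteristic `p` and all `a, b ≥ 2`, the
Segre cone `Spec k[xᵢyⱼ]` (affine cone over `ℙᵃ⁻¹ × ℙᵇ⁻¹ ⊆ ℙ^{ab−1}`): has dimension `a + b − 1` (`segre_ringKrullDim_eq`);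
its coordinate ring is a domain with EVERY ideal tightly closed (`segreCone_residualClass` — so it lies in the residual class
of the crux, `segreCone_fRationalHypothesis`); it has EXACTLY ONE singular point (`segreCone_compl_regularLocus_eq_singleton`);
and it HAS a resolution of singularities (`hasResolution_segreCone`: one blow-up of that point, with regular charts
`≅ 𝔸^{a+b−1}`). Taking `b = 2`, `a = n − 1`: a resolved isolated singular member of the residual class in every dimension
`n ≥ 3`, every characteristic. [folklore] -/
theorem segreCone_specimen (p : ℕ) [Fact p.Prime] [CharP k p] (a b : ℕ) (ha : 2 ≤ a) (hb : 2 ≤ b) :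
    ringKrullDim ↥SR[a, b] = (a + b - 1 : ℕ) ∧
    (IsDomain ↥SR[a, b] ∧ ∀ I : Ideal ↥SR[a, b], ∀ y c : ↥SR[a, b], c ≠ 0 →
      (∀ e : ℕ, c * y ^ p ^ e ∈ Ideal.span ((fun z : ↥SR[a, b] => z ^ p ^ e) '' (I : Set ↥SR[a, b]))) → y ∈ I) ∧
    (∃ q : Spec (CommRingCat.of ↥SR[a, b]), (Scheme.regularLocus (Spec (CommRingCat.of ↥SR[a, b])))ᶜ = {q}) ∧
    Scheme.HasResolution (Spec (CommRingCat.of ↥SR[a, b])) :=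
  ⟨segre_ringKrullDim_eq k a b ⟨0, by omega⟩ ⟨0, by omega⟩, segreCone_residualClass k p a b,
    segreCone_compl_regularLocus_eq_singleton k a b ha hb, hasResolution_segreCone k a b ⟨0, by omega⟩ ⟨0, by omega⟩⟩

end Cones

end Summit.ResolutionOfSingularities.ResolutionOfSingularities.Theorems.FRationalResolution

end
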